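import Mathlib
import HarnessLib
import Summits.RiemannHypothesis.RiemannHypothesis.Theorems.IntegerScrewHarmonicKDefs

/-!
# Route `IntegerScrew` — the continuum return function `K(u,r)` and its two HARMONIC IDENTITIES
# (H1), (H2): the elementary-function layer of THEOREM C♯ (PIVOT-LAW 13.44 / CONTINUUM-LIMIT §16.3)

PIVOT-LAW §13.44 (HOME/pivot/, THEOREM C♯) proves the two-sided return law of the truncated
multiplicative walk of PROP. N4 (`IntegerScrewVonMangoldtCouplingDirichletForm`) in the window `t = τ/log M`
by HARMONIC TRANSFER: the comparison function `h̃(u;x) = K(u,ρ_x)·∏_{p ∣ x}(1 − e^{−uθ_p})` is, to first order,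
space-time harmonic for the walk, and the only analytic inputs of that computation (CONTINUUM-LIMIT 16.3,
«a slip in (H2) would break 16.4») are two identities of the explicit function

  `K(u,r) = (1 − e^{−u(1+r)})/u − (1 − e^{−u})(1 − e^{−ur})/u²`

(LEMMA G: the probability that the constrained continuum process started with room `r` and no particle is
empty at time `u`; `K(u,1) = g(u)` is THEOREM C's limit return law `g(τ) = ∫₀² |1−λ| e^{−τλ} dλ`):

* **(H1)** `K(u, r+x) − K(u, r) = (1 − e^{−ux}) e^{−ur} c(u)` with `c(u) = ((1+u)e^{−u} − 1)/u² < 0` — because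
  `K` is AFFINE in `e^{−ur}`: `K(u,r) = A(u) − c(u)e^{−ur}`, `A(u) = (u − 1 + e^{−u})/u² > 0`
  (`ccpK_eq_ccpA_sub`, `ccpK_add_sub`); hence `K` is positive and non-increasing in the room `r`;
* **(H2)** `∂_u K(u,r) = (1 − r) e^{−ur} c(u) + I(u,r)`, `I(u,r) = ∫₀^r [K(u,r−θ)(1 − e^{−uθ}) − K(u,r)] dθ`, with
  the closed form `I = 2abr/u − [(1+a)(1−b) + 2(1−a)br]/u² + 2(1−a)(1−b)/u³`, `a = e^{−u}`, `b = e^{−ur}`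
  (`hasDerivAt_ccpK` for the derivative with the closed form, `integral_ccpK_shift_eq_ccpI` for the integral);
* `K(u,1) = g(u)`, `g(τ) ≤ 1/τ` (the inequality used in THEOREM N6₁/N6₂'s window bookkeeping: `τ − τ²g(τ)
  = (1 − e^{−τ})² + τe^{−2τ} ≥ 0`), `0 < g`;
* `K(u,r) → 1` as `u → 0` (`tendsto_ccpK_zero`: the continuity of the comparison function at `u = 0` that
  the transfer lemma 16.1 needs), and THEOREM C's integral form `g(u) = ∫₀² |1−λ| e^{−uλ} dλ`
  (`ccpg_eq_integral_abs`; with `A(u) = ∫₀¹ (1−λ)e^{−uλ}dλ`, `ccpA_eq_integral`).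

Everything here is calculus on `exp`; RH-free and walk-free.  Nothing in this file bears on the truth of RH.
References: PIVOT-LAW §13.44, CONTINUUM-LIMIT §16.2–16.3 and §21.1 (K2) (rh-explicit, A6-PIVOT theory);
M. Suzuki, J. Lond. Math. Soc. (2) 108 (2023) 1448–1487 [Suzuki2023] for the screw matrices whose pivot law
this serves.
-/

noncomputable section

-- D-0017: `Summit.<S>.<S>.…` is the designed namespace of a single-problem summit.
set_option linter.dupNamespace false

namespace Summit.RiemannHypothesis.RiemannHypothesis.Theorems.IntegerScrew

open Real intervalIntegral

/-! ## Splitting the exponentials -/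

/-- `e^{−u(1+r)} = e^{−u}·e^{−ur}`. -/
theorem exp_neg_mul_one_add (u r : ℝ) : exp (-(u * (1 + r))) = exp (-u) * exp (-(u * r)) := by
  rw [← exp_add]; ring_nf

/-- `e^{−u(r+x)} = e^{−ur}·e^{−ux}`. -/
theorem exp_neg_mul_add (u r x : ℝ) : exp (-(u * (r + x))) = exp (-(u * r)) * exp (-(u * x)) := by
  rw [← exp_add]; ring_nf

/-- `e^{−2u} = e^{−u}·e^{−u}`. -/
theorem exp_neg_two_mul' (u : ℝ) : exp (-(2 * u)) = exp (-u) * exp (-u) := by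
  rw [← exp_add]; ring_nf

/-- `e^{−u(r−θ)} = e^{−ur}·e^{uθ}`. -/
theorem exp_neg_mul_sub (u r θ : ℝ) : exp (-(u * (r - θ))) = exp (-(u * r)) * exp (u * θ) := by
  rw [← exp_add]; ring_nf

/-! ## (H1): `K` is affine in `e^{−ur}` -/

/-- `K(u,r) = A(u) − c(u)·e^{−ur}` (`u ≠ 0`). -/
theorem ccpK_eq_ccpA_sub {u : ℝ} (hu : u ≠ 0) (r : ℝ) :
    ccpK u r = ccpA u - ccpc u * exp (-(u * r)) := by
  unfold ccpK ccpA ccpc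
  rw [exp_neg_mul_one_add]
  field_simp
  ring

/-- **(H1)** `K(u,r+x) − K(u,r) = (1 − e^{−ux})·e^{−ur}·c(u)` (`u ≠ 0`; CONTINUUM-LIMIT 16.3). -/
theorem ccpK_add_sub {u : ℝ} (hu : u ≠ 0) (r x : ℝ) :
    ccpK u (r + x) - ccpK u r = (1 - exp (-(u * x))) * exp (-(u * r)) * ccpc u := by
  rw [ccpK_eq_ccpA_sub hu, ccpK_eq_ccpA_sub hu, exp_neg_mul_add]
  ring

/-- `K(u,0) = (1 − e^{−u})/u`. -/
theorem ccpK_zero_right (u : ℝ) : ccpK u 0 = (1 - exp (-u)) / u := by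
  unfold ccpK
  simp only [mul_zero, neg_zero, exp_zero, sub_self, zero_div, sub_zero, add_zero, mul_one]

/-- `K(u,1) = g(u)`: the room factor from full room is THEOREM C's `g`. -/
theorem ccpK_one {u : ℝ} (hu : u ≠ 0) : ccpK u 1 = ccpg u := by
  unfold ccpK ccpg
  rw [show -(u * (1 + 1)) = -(2 * u) by ring, exp_neg_two_mul', mul_one]
  field_simp
  ring

/-- `c(u) < 0` for `u > 0` (`(1+u)e^{−u} < 1`). -/
theorem ccpc_neg {u : ℝ} (hu : 0 < u) : ccpc u < 0 := by
  unfold ccpc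
  apply div_neg_of_neg_of_pos _ (by positivity)
  have h1 : u + 1 < exp u := add_one_lt_exp hu.ne'
  have h2 : (1 + u) * exp (-u) = (1 + u) / exp u := by rw [exp_neg, div_eq_mul_inv]
  rw [h2, sub_neg, div_lt_one (exp_pos u)]
  linarith

/-- `A(u) > 0` for `u > 0` (`e^{−u} > 1 − u`). -/
theorem ccpA_pos {u : ℝ} (hu : 0 < u) : 0 < ccpA u := by
  unfold ccpA
  apply div_pos _ (by positivity)
  have h1 : -u + 1 < exp (-u) := add_one_lt_exp (neg_ne_zero.mpr hu.ne')
  linarith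

/-- `K(u,r) > 0` for `u > 0` and every real `r`. -/
theorem ccpK_pos {u : ℝ} (hu : 0 < u) (r : ℝ) : 0 < ccpK u r := by
  rw [ccpK_eq_ccpA_sub hu.ne']
  have hA := ccpA_pos hu
  have hc := ccpc_neg hu
  have he := exp_pos (-(u * r))
  nlinarith

/-- `K` is non-increasing in the room: `K(u,r+x) ≤ K(u,r)` for `u > 0`, `x ≥ 0` (from (H1) and `c < 0`). -/
theorem ccpK_add_le {u : ℝ} (hu : 0 < u) (r : ℝ) {x : ℝ} (hx : 0 ≤ x) :
    ccpK u (r + x) ≤ ccpK u r := by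
  have h := ccpK_add_sub hu.ne' r x
  have h1 : 0 ≤ 1 - exp (-(u * x)) := by
    rw [sub_nonneg]
    exact exp_le_one_iff.mpr (by nlinarith)
  have h2 := (exp_pos (-(u * r))).le
  have h3 := (ccpc_neg hu).le
  have : (1 - exp (-(u * x))) * exp (-(u * r)) * ccpc u ≤ 0 :=
    mul_nonpos_of_nonneg_of_nonpos (mul_nonneg h1 h2) h3
  linarith

/-- In particular `K(u,ρ) ≥ K(u,1) = g(u)` for rooms `ρ ≤ 1` and `K(u,ρ) ≤ K(u,0)` for `ρ ≥ 0` (`u > 0`),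
the two comparisons used throughout CONTINUUM-LIMIT 16.5. -/
theorem ccpg_le_ccpK_of_le_one {u : ℝ} (hu : 0 < u) {ρ : ℝ} (hρ : ρ ≤ 1) : ccpg u ≤ ccpK u ρ := by
  have h := ccpK_add_le hu ρ (sub_nonneg.mpr hρ)
  rw [add_sub_cancel, ccpK_one hu.ne'] at h
  exact h

/-- `K(u,ρ) ≤ K(u,0)` for rooms `ρ ≥ 0` (`u > 0`). -/
theorem ccpK_le_ccpK_zero_of_nonneg {u : ℝ} (hu : 0 < u) {ρ : ℝ} (hρ : 0 ≤ ρ) : ccpK u ρ ≤ ccpK u 0 := by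
  have h := ccpK_add_le hu 0 hρ
  rw [zero_add] at h
  exact h

/-! ## `g`: positivity and `g(τ) ≤ 1/τ` -/

/-- `g(u) > 0` for `u > 0`. -/
theorem ccpg_pos {u : ℝ} (hu : 0 < u) : 0 < ccpg u := by
  rw [← ccpK_one hu.ne']; exact ccpK_pos hu 1

/-- `1/τ − g(τ) = ((1 − e^{−τ})² + τe^{−2τ})/τ²`: the identity behind `g ≤ 1/τ` (CONTINUUM-LIMIT 17.2). -/
theorem inv_sub_ccpg_eq {u : ℝ} (hu : u ≠ 0) :
    1 / u - ccpg u = ((1 - exp (-u)) ^ 2 + u * exp (-u) ^ 2) / u ^ 2 := by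
  unfold ccpg
  rw [exp_neg_two_mul']
  field_simp
  ring

/-- `g(τ) ≤ 1/τ` for `τ > 0` (so `τ·g(τ) ≤ 1`: the bound that makes `∫_{τ₀}^{T} g ≤ log(T/τ₀)`). -/
theorem ccpg_le_inv {u : ℝ} (hu : 0 < u) : ccpg u ≤ 1 / u := by
  have h := inv_sub_ccpg_eq hu.ne'
  have : 0 ≤ ((1 - exp (-u)) ^ 2 + u * exp (-u) ^ 2) / u ^ 2 := by positivity
  linarith

/-! ## (H2): the `u`-derivative of `K` and the integral `I` -/

/-- **(H2), derivative half**: `∂_u K(u,r) = (1 − r)e^{−ur}c(u) + I(u,r)` with `I` in closed form (`u ≠ 0`). -/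
theorem hasDerivAt_ccpK {u : ℝ} (hu : u ≠ 0) (r : ℝ) :
    HasDerivAt (fun v => ccpK v r) ((1 - r) * exp (-(u * r)) * ccpc u + ccpI u r) u := by
  have h1 : HasDerivAt (fun v : ℝ => -(v * (1 + r))) (-(1 + r)) u :=
    ((hasDerivAt_id' u).mul_const (1 + r)).fun_neg.congr_deriv (by ring)
  have ha : HasDerivAt (fun v : ℝ => -v) (-1) u := (hasDerivAt_id' u).fun_neg.congr_deriv (by ring)
  have hb : HasDerivAt (fun v : ℝ => -(v * r)) (-r) u :=
    ((hasDerivAt_id' u).mul_const r).fun_neg.congr_deriv (by ring)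
  have sq : HasDerivAt (fun v : ℝ => v ^ 2) (2 * u) u := (hasDerivAt_pow 2 u).congr_deriv (by ring)
  have d1 := (h1.exp.const_sub 1).fun_div (hasDerivAt_id' u) hu
  have d2 := ((ha.exp.const_sub 1).fun_mul (hb.exp.const_sub 1)).fun_div sq (pow_ne_zero 2 hu)
  refine (d1.fun_sub d2).congr_deriv ?_
  unfold ccpc ccpI
  rw [exp_neg_mul_one_add]
  field_simp
  ring

/-- The integrand of `I(u,r)` expanded: `K(u,r−θ)(1 − e^{−uθ}) − K(u,r) = −A e^{−uθ} − c e^{−ur}e^{uθ} + 2c e^{−ur}`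
(`u ≠ 0`). -/
theorem ccpK_shift_integrand_eq {u : ℝ} (hu : u ≠ 0) (r θ : ℝ) :
    ccpK u (r - θ) * (1 - exp (-(u * θ))) - ccpK u r =
      -ccpA u * exp (-(u * θ)) - ccpc u * exp (-(u * r)) * exp (u * θ)
        + 2 * ccpc u * exp (-(u * r)) := by
  rw [ccpK_eq_ccpA_sub hu, ccpK_eq_ccpA_sub hu, exp_neg_mul_sub]
  have hE : exp (u * θ) * exp (-(u * θ)) = 1 := by rw [← exp_add, add_neg_cancel, exp_zero]
  linear_combination (ccpc u * exp (-(u * r))) * hE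

/-- An antiderivative in `θ` of the integrand of `I(u,r)` (`u ≠ 0`). -/
theorem hasDerivAt_ccpI_antideriv {u : ℝ} (hu : u ≠ 0) (r θ : ℝ) :
    HasDerivAt (fun t : ℝ => ccpA u / u * exp (-(u * t)) - ccpc u * exp (-(u * r)) / u * exp (u * t)
        + 2 * ccpc u * exp (-(u * r)) * t)
      (ccpK u (r - θ) * (1 - exp (-(u * θ))) - ccpK u r) θ := by
  rw [ccpK_shift_integrand_eq hu]
  have hq : HasDerivAt (fun t : ℝ => -(u * t)) (-u) θ :=
    ((hasDerivAt_id' θ).const_mul u).fun_neg.congr_deriv (by ring)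
  have hp : HasDerivAt (fun t : ℝ => u * t) u θ := ((hasDerivAt_id' θ).const_mul u).congr_deriv (by ring)
  have h := ((hq.exp.const_mul (ccpA u / u)).fun_sub
    (hp.exp.const_mul (ccpc u * exp (-(u * r)) / u))).fun_add
    ((hasDerivAt_id' θ).const_mul (2 * ccpc u * exp (-(u * r))))
  refine h.congr_deriv ?_
  field_simp

/-- **(H2), integral half**: `∫₀^r [K(u,r−θ)(1 − e^{−uθ}) − K(u,r)] dθ = I(u,r)` with `I` the closed form
`ccpI` (`u ≠ 0`; CONTINUUM-LIMIT 16.3).  Together with `hasDerivAt_ccpK` this is (H2) as printed: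
`∂_uK(u,r) = (1−r)e^{−ur}c(u) + ∫₀^r[K(u,r−θ)φ(θ) − K(u,r)]dθ`. -/
theorem integral_ccpK_shift_eq_ccpI {u : ℝ} (hu : u ≠ 0) (r : ℝ) :
    ∫ θ in (0 : ℝ)..r, (ccpK u (r - θ) * (1 - exp (-(u * θ))) - ccpK u r) = ccpI u r := by
  have hcont : Continuous fun θ : ℝ => ccpK u (r - θ) * (1 - exp (-(u * θ))) - ccpK u r := by
    unfold ccpK; fun_prop
  rw [integral_eq_sub_of_hasDerivAt (fun θ _ => hasDerivAt_ccpI_antideriv hu r θ)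
    (hcont.intervalIntegrable _ _)]
  have hb : exp (-(u * r)) ≠ 0 := exp_ne_zero _
  simp only [mul_zero, neg_zero, exp_zero, mul_one]
  rw [show exp (u * r) = (exp (-(u * r)))⁻¹ by rw [exp_neg, inv_inv]]
  unfold ccpI ccpA ccpc
  field_simp
  ring

/-- **(H2)** in the printed form: `∂_u K(u,r) = (1 − r)e^{−ur}c(u) + ∫₀^r [K(u,r−θ)(1 − e^{−uθ}) − K(u,r)] dθ`
(`u ≠ 0`). -/
theorem hasDerivAt_ccpK_integral {u : ℝ} (hu : u ≠ 0) (r : ℝ) :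
    HasDerivAt (fun v => ccpK v r)
      ((1 - r) * exp (-(u * r)) * ccpc u
        + ∫ θ in (0 : ℝ)..r, (ccpK u (r - θ) * (1 - exp (-(u * θ))) - ccpK u r)) u := by
  rw [integral_ccpK_shift_eq_ccpI hu]
  exact hasDerivAt_ccpK hu r

/-! ## Continuity at `u = 0`: `K(0⁺, r) = 1` (the transfer lemma's hypothesis `h̃(0;x) = 𝟙[x = 1]`) -/

/-- `(1 − e^{−ua})/u → a` as `u → 0`, `u ≠ 0` (the derivative of `−e^{−ua}` at `0`). -/
theorem tendsto_one_sub_exp_neg_mul_div (a : ℝ) :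
    Filter.Tendsto (fun u : ℝ => (1 - exp (-(u * a))) / u) (nhdsWithin 0 {0}ᶜ) (nhds a) := by
  have h : HasDerivAt (fun u : ℝ => -exp (-(u * a))) a 0 := by
    refine (((hasDerivAt_id' (0 : ℝ)).mul_const a).fun_neg.exp.fun_neg).congr_deriv ?_
    simp
  refine h.tendsto_slope_zero.congr fun t => ?_
  simp only [zero_add, zero_mul, neg_zero, exp_zero, smul_eq_mul]
  ring

/-- **`K(u,r) → 1` as `u → 0` (`u ≠ 0`)**: with `∏_{p∣x}(1 − e^{−uθ_p}) → 𝟙[x = 1]` this is the continuity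
of THEOREM C♯'s comparison function at `u = 0` required by the transfer lemma (CONTINUUM-LIMIT 16.1–16.2,
§21.1 (K1)): `(1 − e^{−u(1+r)})/u → 1 + r` and `(1−e^{−u})(1−e^{−ur})/u² → 1·r`. -/
theorem tendsto_ccpK_zero (r : ℝ) :
    Filter.Tendsto (fun u : ℝ => ccpK u r) (nhdsWithin 0 {0}ᶜ) (nhds 1) := by
  have h1 := tendsto_one_sub_exp_neg_mul_div (1 + r)
  have h2 : Filter.Tendsto (fun u : ℝ => (1 - exp (-u)) / u) (nhdsWithin 0 {0}ᶜ) (nhds 1) := by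
    refine (tendsto_one_sub_exp_neg_mul_div 1).congr fun u => ?_
    rw [mul_one]
  have h3 := tendsto_one_sub_exp_neg_mul_div r
  have h := h1.sub (h2.mul h3)
  rw [show (1 + r) - 1 * r = (1 : ℝ) by ring] at h
  refine h.congr fun u => ?_
  unfold ccpK
  ring

/-! ## THEOREM C's integral form: `g(u) = ∫₀² |1 − λ| e^{−uλ} dλ` and `A(u) = ∫₀¹ (1 − λ) e^{−uλ} dλ` -/

/-- Antiderivative of `(1 − λ)e^{−uλ}` in `λ`: `e^{−uλ}(λ/u + (1−u)/u²)` (`u ≠ 0`). -/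
theorem hasDerivAt_ccp_window_antideriv {u : ℝ} (hu : u ≠ 0) (t : ℝ) :
    HasDerivAt (fun s : ℝ => exp (-(u * s)) * (s / u + (1 - u) / u ^ 2)) ((1 - t) * exp (-(u * t))) t := by
  have hq : HasDerivAt (fun s : ℝ => -(u * s)) (-u) t :=
    ((hasDerivAt_id' t).const_mul u).fun_neg.congr_deriv (by ring)
  have hl : HasDerivAt (fun s : ℝ => s / u + (1 - u) / u ^ 2) (1 / u) t := by
    refine (((hasDerivAt_id' t).div_const u).add_const ((1 - u) / u ^ 2)).congr_deriv ?_
    simp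
  refine (hq.exp.fun_mul hl).congr_deriv ?_
  field_simp
  ring

/-- `A(u) = ∫₀¹ (1 − λ) e^{−uλ} dλ` (`u ≠ 0`) — whence `A > 0` once more, and the `λ ≤ 1` half of `g`. -/
theorem ccpA_eq_integral {u : ℝ} (hu : u ≠ 0) :
    ccpA u = ∫ s in (0 : ℝ)..1, (1 - s) * exp (-(u * s)) := by
  rw [integral_eq_sub_of_hasDerivAt (fun t _ => hasDerivAt_ccp_window_antideriv hu t)
    ((by fun_prop : Continuous fun s : ℝ => (1 - s) * exp (-(u * s))).intervalIntegrable _ _)]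
  unfold ccpA
  simp only [mul_one, mul_zero, neg_zero, exp_zero, zero_div, zero_add, one_mul]
  field_simp
  ring

/-- The `λ ≥ 1` half: `∫₁² (λ − 1) e^{−uλ} dλ = (e^{−u} − (1+u)e^{−2u})/u²` (`u ≠ 0`). -/
theorem integral_ccp_window_upper {u : ℝ} (hu : u ≠ 0) :
    ∫ s in (1 : ℝ)..2, (s - 1) * exp (-(u * s)) = (exp (-u) - (1 + u) * exp (-(2 * u))) / u ^ 2 := by
  have h : ∀ t ∈ Set.uIcc (1 : ℝ) 2, HasDerivAt (fun s : ℝ => -(exp (-(u * s)) * (s / u + (1 - u) / u ^ 2)))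
      ((t - 1) * exp (-(u * t))) t := fun t _ =>
    (hasDerivAt_ccp_window_antideriv hu t).fun_neg.congr_deriv (by ring)
  rw [integral_eq_sub_of_hasDerivAt h
    ((by fun_prop : Continuous fun s : ℝ => (s - 1) * exp (-(u * s))).intervalIntegrable _ _)]
  rw [show -(u * 2) = -(2 * u) by ring, mul_one]
  field_simp
  ring

/-- **THEOREM C's limit law in integral form**: `g(u) = ∫₀² |1 − λ| e^{−uλ} dλ` (`u ≠ 0`; CONTINUUM-LIMIT §0 /
2.5 (a): the spectral measure `|1 − λ|dλ` on `[0,2]` of the constrained continuum process at `∅`). -/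
theorem ccpg_eq_integral_abs {u : ℝ} (hu : u ≠ 0) :
    ccpg u = ∫ s in (0 : ℝ)..2, |1 - s| * exp (-(u * s)) := by
  have hint : ∀ a b : ℝ, IntervalIntegrable (fun s : ℝ => |1 - s| * exp (-(u * s))) MeasureTheory.volume a b :=
    fun a b => ((by fun_prop : Continuous fun s : ℝ => |1 - s| * exp (-(u * s))).intervalIntegrable a b)
  rw [← integral_add_adjacent_intervals (hint 0 1) (hint 1 2)]
  have h1 : ∫ s in (0 : ℝ)..1, |1 - s| * exp (-(u * s)) = ∫ s in (0 : ℝ)..1, (1 - s) * exp (-(u * s)) := by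
    refine integral_congr fun s hs => ?_
    rw [Set.uIcc_of_le zero_le_one] at hs
    simp only [abs_of_nonneg (sub_nonneg.mpr hs.2)]
  have h2 : ∫ s in (1 : ℝ)..2, |1 - s| * exp (-(u * s)) = ∫ s in (1 : ℝ)..2, (s - 1) * exp (-(u * s)) := by
    refine integral_congr fun s hs => ?_
    rw [Set.uIcc_of_le one_le_two] at hs
    simp only [abs_of_nonpos (sub_nonpos.mpr hs.1), neg_sub]
  rw [h1, h2, ← ccpA_eq_integral hu, integral_ccp_window_upper hu]
  unfold ccpg ccpA
  field_simp
  ring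

end Summit.RiemannHypothesis.RiemannHypothesis.Theorems.IntegerScrew

end
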